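import Literature.NumberTheory.Transcendental.ManyCurveThetaClassification
import Literature.NumberTheory.Transcendental.CurvePeriodsEllipticEndgameProofs

/-!
# Crux `RealOnePeriodRelations` (stmt-KontsevichZagierPeriods-10042), line `nash-retraction-thin-strip`:
# stub `stub_logsManyCurve` — Baker's theorem and Huber–Wüstholz Thm 15.3 (1), jointly

For pairwise non-isogenous lattices `Λ₁, …, Λ_k` with algebraic invariants (CM allowed) and
`ℚ`-linearly independent logarithms `y_j` of algebraic numbers, a vanishing algebraic combination
`α + Σ_j μ_j y_j + Σ_i (a_i ω₁⁽ⁱ⁾ + b_i ω₂⁽ⁱ⁾ + c_i η₁⁽ⁱ⁾ + d_i η₂⁽ⁱ⁾) = 0` has `α = 0`, every `μ_j = 0`,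
every block zero, and `a_i = b_i = c_i = d_i = 0` on the lattices without CM (`stub_logsManyCurve`):
the tree's `HuberWustholzManyCurvePeriods` (torus `𝔾ₘ` at `2πi`) with the torus `𝔾ₘ^ι` at `y`.
Route: the family semistability engine (`GaGmEFam.Std.stableClosing_of_philippon philippon_family`,
Baker's method + Philippon's zero estimate on the family standard models `𝔾ₘ^β × P` at all
algebraic points of the torus, torsion abelian part) gives the alternatives at the point
`(y; ω₁⁽ⁱ⁾ | ω₂^{(e s)}; (1; η₁⁽ⁱ⁾ | η₂^{(e s)}))` of `Lie(𝔾ₘ^ι × P₀)` (`logs_alternatives`); they are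
excluded by `1 ≠ 0`, the `ℚ`-independence of `y` and the `ℝ`-independence of `ω₁, ω₂`
(`logs_core_of_alternatives`, `logs_core` — the tree's `ManyCurve.core_of_alternatives` with `y`
for `2πi`), and the CM blocks are put in normal form (`logs_of_core_at`).

References: A. Huber, G. Wüstholz, *Transcendence and Linear Relations of 1-Periods*, Cambridge
Tracts 227 (2022), Thm 15.3 (1),(3), Thm 6.2; A. Baker, G. Wüstholz, *Logarithmic Forms and
Diophantine Geometry* (2007), Thm. 6.15, §6.8; D. Masser, LNM 437 (1975), Ch. III.
-/

noncomputable section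

open Complex

open Literature.NumberTheory.Transcendental

namespace Summit.KontsevichZagierPeriods.SymplecticScissors.RealOnePeriodRelations.LogLoopLayer

/-! ## The alternatives at a vector of logarithms and periods -/

open Literature.NumberTheory.Transcendental.GaGmEFam
  Literature.NumberTheory.Transcendental.GaGmEFam.Std
  Literature.NumberTheory.Transcendental.GaGmE.Std in
/-- **The alternatives at a point `(y; z; (x; t))` of `Lie(𝔾ₘ^ι × P₀)`**, `P₀ = 𝔾ₐ × ∏_b E_{cls b}♮`
(pairwise non-isogenous lattices with algebraic invariants, CM classes with one block), with
`e^{y_j} ∈ ℚ̄`, `x ∈ ℚ̄` and `(z_b, t_b)` period vectors of `Λ_{cls b}`: a `ℚ̄`-dependence of the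
coordinates forces `x = 0`, or an integer relation among the `y_j`, or one among the `z`-coordinates
of ONE class — by the tree's family semistability chain (Baker's method + Philippon's zero estimate
on `𝔾ₘ^β × P`). [cite: BakerWustholz2007, Thm. 6.15, §6.8] [cite: HuberWustholz2022, Thm 6.2, Thm 15.3 (1)] -/
theorem logs_alternatives {J : Type} [Fintype J] [DecidableEq J] (L : J → PeriodPair)
    (hL : ∀ i, IsAlgebraic ℚ (L i).g₂ ∧ IsAlgebraic ℚ (L i).g₃)
    (hiso : ∀ i j, i ≠ j → ¬ (L i).IsIsogenousTo (L j))
    {ι γ : Type} [Fintype ι] [Fintype γ] [DecidableEq γ] (cls : γ → J)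
    (hcm1 : ∀ b b', cls b = cls b' → (L (cls b)).HasCM → b = b')
    (x : ℂ) (y : ι → ℂ) (m n : γ → ℤ) (hx : IsAlgebraic ℚ x) (hy : ∀ j, IsAlgebraic ℚ (cexp (y j)))
    (hdep : ¬ QbarLinearIndependent
      (GaGmE.Std.coords y (fun b => (m b : ℂ) * (L (cls b)).ω₁ + (n b : ℂ) * (L (cls b)).ω₂)
        (Sum.elim (fun _ : Unit => x)
          (fun b => (m b : ℂ) * (L (cls b)).η₁ + (n b : ℂ) * (L (cls b)).η₂)))) :
    x = 0 ∨ (∃ p : ι → ℤ, p ≠ 0 ∧ ∑ j, (p j : ℂ) * y j = 0) ∨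
      (∃ (i : J) (a : γ → ℤ), a ≠ 0 ∧ (∀ b, cls b ≠ i → a b = 0) ∧
        ∑ b, (a b : ℂ) * ((m b : ℂ) * (L (cls b)).ω₁ + (n b : ℂ) * (L (cls b)).ω₂) = 0) := by
  have hstd := semistabilityTheorem_std_tors_of_stableClosing
    (stableClosing_of_philippon philippon_family)
  have hstdH := std_torsHyperplane_of_std_tors hstd
  have hH := hyperplaneTheorem_presTors_of_std_torsHyperplane hstdH J L hL hiso ι γ (Unit ⊕ γ) cls
    hcm1 (κM₀ γ)
  exact periods_alternatives_of_hyperplaneTheorem hL hH x y m n hx hy hdep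

/-! ## The core: the alternatives excluded -/

/-- **The core at a family, from the alternatives at ONE point.** `e : S ↪ Fin k` enumerates the
indices WITHOUT complex multiplication, `y : ι → ℂ` is `ℚ`-linearly independent; blocks
`B = Fin k ⊕ S`, classes `cls = Sum.elim id e` (class `i`: block `inl i` carrying `(ω₁⁽ⁱ⁾, η₁⁽ⁱ⁾)`
and, if `Λᵢ` has no CM, block `inr s`, `e s = i`, carrying `(ω₂⁽ⁱ⁾, η₂⁽ⁱ⁾)`). If a `ℚ̄`-dependence
of the coordinates of `u = (1; y; z; t)` forces `1 = 0`, or an integer relation among the `y_j`, or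
one among the `z`-coordinates of one class, then a vanishing `ℚ̄`-combination
`α + Σ_j μ_j y_j + ∑ᵢ (aᵢω₁⁽ⁱ⁾ + bᵢω₂⁽ⁱ⁾ + cᵢη₁⁽ⁱ⁾ + dᵢη₂⁽ⁱ⁾) = 0` with `bᵢ = dᵢ = 0` on the CM
indices is trivial: the alternatives are excluded by `1 ≠ 0`, the `ℚ`-independence of `y`,
`ω₁⁽ⁱ⁾ ≠ 0` (CM classes) and the `ℝ`-independence of `ω₁⁽ⁱ⁾, ω₂⁽ⁱ⁾` (non-CM classes). The tree's
`ManyCurve.core_of_alternatives` with `y` for `2πi`. [cite: HuberWustholz2022, Thm. 15.3 (1), Thm. 6.2; Prop. 15.20] -/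
theorem logs_core_of_alternatives {k : ℕ} {L : Fin k → PeriodPair} {S : Type} [Fintype S]
    (e : S → Fin k) (he : Function.Injective e) (hS : ∀ s, ¬ (L (e s)).HasCM)
    (hS' : ∀ i, ¬ (L i).HasCM → ∃ s, e s = i)
    {ι : Type} [Fintype ι] {y : ι → ℂ} (hyind : LinearIndependent ℚ y)
    (halt : ¬ QbarLinearIndependent
        (lieCoords 1 y
          (Sum.elim (fun i => (L i).ω₁) (fun s => (L (e s)).ω₂) : Fin k ⊕ S → ℂ)
          (Sum.elim (fun i => (L i).η₁) (fun s => (L (e s)).η₂) : Fin k ⊕ S → ℂ)) →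
      (1 : ℂ) = 0 ∨ (∃ p : ι → ℤ, p ≠ 0 ∧ ∑ j, (p j : ℂ) * y j = 0) ∨
        (∃ (i : Fin k) (a : Fin k ⊕ S → ℤ), a ≠ 0 ∧
          (∀ b, Sum.elim id e b ≠ i → a b = 0) ∧
          ∑ b, (a b : ℂ) *
            (Sum.elim (fun i => (L i).ω₁) (fun s => (L (e s)).ω₂) : Fin k ⊕ S → ℂ) b = 0))
    (α : ℂ) (μ : ι → ℂ) (a b c d : Fin k → ℂ) (hα : IsAlgebraic ℚ α)
    (hμ : ∀ j, IsAlgebraic ℚ (μ j))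
    (habcd : ∀ i, IsAlgebraic ℚ (a i) ∧ IsAlgebraic ℚ (b i) ∧ IsAlgebraic ℚ (c i) ∧
      IsAlgebraic ℚ (d i))
    (hcm : ∀ i, (L i).HasCM → b i = 0 ∧ d i = 0)
    (hsum : α + ∑ j, μ j * y j +
      ∑ i, (a i * (L i).ω₁ + b i * (L i).ω₂ + c i * (L i).η₁ + d i * (L i).η₂) = 0) :
    α = 0 ∧ (∀ j, μ j = 0) ∧ ∀ i, a i = 0 ∧ b i = 0 ∧ c i = 0 ∧ d i = 0 := by
  -- adapted from `ManyCurve.core_of_alternatives`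
  classical
  -- `b` and `d` vanish off the range of `e`
  have hbd0 : ∀ i, (∀ s, e s ≠ i) → b i = 0 ∧ d i = 0 := fun i hi => by
    by_cases hCM : (L i).HasCM
    · exact hcm i hCM
    · obtain ⟨s, hs⟩ := hS' i hCM
      exact absurd hs (hi s)
  -- the coefficient family and the point
  set γ : Unit ⊕ (ι ⊕ ((Fin k ⊕ S) ⊕ (Fin k ⊕ S))) → ℂ :=
    lieCoords α μ (Sum.elim a (fun s => b (e s))) (Sum.elim c (fun s => d (e s))) with hγ
  set u : Unit ⊕ (ι ⊕ ((Fin k ⊕ S) ⊕ (Fin k ⊕ S))) → ℂ :=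
    lieCoords 1 y
      (Sum.elim (fun i => (L i).ω₁) (fun s => (L (e s)).ω₂))
      (Sum.elim (fun i => (L i).η₁) (fun s => (L (e s)).η₂)) with hu
  have hγalg : ∀ σ, IsAlgebraic ℚ (γ σ) := by
    rintro (_ | j | (i | s) | (i | s))
    · exact hα
    · simpa [hγ] using hμ j
    · simpa [hγ] using (habcd i).1
    · simpa [hγ] using (habcd (e s)).2.1
    · simpa [hγ] using (habcd i).2.2.1
    · simpa [hγ] using (habcd (e s)).2.2.2
  have hγsum : ∑ σ, γ σ * u σ = 0 := by
    have hsplit : ∑ i, (a i * (L i).ω₁ + b i * (L i).ω₂ + c i * (L i).η₁ + d i * (L i).η₂) =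
        ∑ i, (a i * (L i).ω₁ + c i * (L i).η₁) +
          ∑ s, (b (e s) * (L (e s)).ω₂ + d (e s) * (L (e s)).η₂) := by
      rw [← ManyCurve.sum_eq_sum_of_support e he (fun i => b i * (L i).ω₂ + d i * (L i).η₂)
        (fun i hi => by rw [(hbd0 i hi).1, (hbd0 i hi).2]; ring), ← Finset.sum_add_distrib]
      refine Finset.sum_congr rfl fun i _ => ?_
      ring
    rw [hsplit] at hsum
    simp only [Fintype.sum_sum_type, Finset.univ_unique, Finset.sum_singleton,
      hγ, hu, lieCoords_inl, lieCoords_inr_inl, lieCoords_inr_inr_inl,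
      lieCoords_inr_inr_inr, Sum.elim_inl, Sum.elim_inr]
    rw [← hsum]
    simp only [Finset.sum_add_distrib]
    ring
  -- if some coefficient is non-zero, the coordinates of `u` are dependent
  by_contra hne
  have hdep : ¬ QbarLinearIndependent u := by
    intro hQ
    have h0 := hQ γ hγalg hγsum
    apply hne
    have hα0 : α = 0 := by simpa [hγ] using h0 (Sum.inl ())
    have hμ0 : ∀ j, μ j = 0 := fun j => by simpa [hγ] using h0 (Sum.inr (Sum.inl j))
    have ha0 : ∀ i, a i = 0 := fun i => by
      simpa [hγ] using h0 (Sum.inr (Sum.inr (Sum.inl (Sum.inl i))))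
    have hc0 : ∀ i, c i = 0 := fun i => by
      simpa [hγ] using h0 (Sum.inr (Sum.inr (Sum.inr (Sum.inl i))))
    have hbS : ∀ s, b (e s) = 0 := fun s => by
      simpa [hγ] using h0 (Sum.inr (Sum.inr (Sum.inl (Sum.inr s))))
    have hdS : ∀ s, d (e s) = 0 := fun s => by
      simpa [hγ] using h0 (Sum.inr (Sum.inr (Sum.inr (Sum.inr s))))
    have hbd : ∀ i, b i = 0 ∧ d i = 0 := fun i => by
      by_cases hi : ∃ s, e s = i
      · obtain ⟨s, rfl⟩ := hi
        exact ⟨hbS s, hdS s⟩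
      · exact hbd0 i (not_exists.mp hi)
    exact ⟨hα0, hμ0, fun i => ⟨ha0 i, (hbd i).1, hc0 i, (hbd i).2⟩⟩
  rcases halt (by rw [hu] at hdep; exact hdep) with h0 | ⟨p, hp, hpy⟩ | ⟨i, n, hn, hsupp, hrel⟩
  · exact one_ne_zero h0
  · exact CurvePeriods.not_int_rel_of_linearIndependent hyind p hp hpy
  · -- an integer relation among the `z`-coordinates of the class `i`
    rw [Fintype.sum_sum_type] at hrel
    simp only [Sum.elim_inl, Sum.elim_inr] at hrel
    -- the `inl`-part is the single term `n (inl i) ω₁⁽ⁱ⁾`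
    have hinl : ∑ j, (n (Sum.inl j) : ℂ) * (L j).ω₁ = (n (Sum.inl i) : ℂ) * (L i).ω₁ := by
      rw [Finset.sum_eq_single i]
      · intro j _ hj
        rw [hsupp (Sum.inl j) (by simpa using hj)]
        simp
      · intro h; exact absurd (Finset.mem_univ i) h
    rw [hinl] at hrel
    by_cases hCM : (L i).HasCM
    · -- CM class: one block, `n (inl i) ω₁ = 0`
      have hinr : ∑ s, (n (Sum.inr s) : ℂ) * (L (e s)).ω₂ = 0 := by
        refine Finset.sum_eq_zero fun s _ => ?_
        rw [hsupp (Sum.inr s) (fun h => hS s (by rw [show e s = i by simpa using h]; exact hCM))]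
        simp
      rw [hinr, add_zero] at hrel
      have hni : n (Sum.inl i) = 0 := by
        have hω : (L i).ω₁ ≠ 0 := by simpa using (L i).indep.ne_zero 0
        exact_mod_cast (mul_eq_zero.mp hrel).resolve_right hω
      apply hn
      funext b'
      rcases b' with j | s
      · by_cases hj : j = i
        · subst hj; exact hni
        · exact hsupp (Sum.inl j) (by simpa using hj)
      · exact hsupp (Sum.inr s) (fun h => hS s (by rw [show e s = i by simpa using h]; exact hCM))
    · -- non-CM class: two blocks, `n (inl i) ω₁ + n (inr s₀) ω₂ = 0`
      obtain ⟨s₀, hs₀⟩ := hS' i hCM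
      have hinr : ∑ s, (n (Sum.inr s) : ℂ) * (L (e s)).ω₂ = (n (Sum.inr s₀) : ℂ) * (L i).ω₂ := by
        rw [Finset.sum_eq_single s₀]
        · rw [hs₀]
        · intro s _ hs
          rw [hsupp (Sum.inr s) (fun h => hs (he (by rw [hs₀]; simpa using h)))]
          simp
        · intro h; exact absurd (Finset.mem_univ s₀) h
      rw [hinr] at hrel
      have h := (L i).not_int_rel_periods ![n (Sum.inl i), n (Sum.inr s₀)] (by
        intro h0
        apply hn
        funext b'
        rcases b' with j | s
        · by_cases hj : j = i
          · subst hj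
            have := congr_fun h0 0
            simpa using this
          · exact hsupp (Sum.inl j) (by simpa using hj)
        · by_cases hs : s = s₀
          · subst hs
            have := congr_fun h0 1
            simpa using this
          · exact hsupp (Sum.inr s) (fun h => hs (he (by rw [hs₀]; simpa using h))))
        (by simpa [Fin.sum_univ_two] using hrel)
      exact h

/-- **The core of `stub_logsManyCurve`.** For pairwise non-isogenous lattices with algebraic
invariants and `ℚ`-linearly independent logarithms `y_j` of algebraic numbers, a vanishing
combination `α + Σ_j μ_j y_j + ∑ᵢ (aᵢω₁⁽ⁱ⁾ + bᵢω₂⁽ⁱ⁾ + cᵢη₁⁽ⁱ⁾ + dᵢη₂⁽ⁱ⁾) = 0` with algebraic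
coefficients AND `bᵢ = dᵢ = 0` on the CM lattices is trivial (`ℚ̄`-linear independence of the
`1 + |ι| + ∑ᵢ 4/e(Eᵢ)` numbers `1, y_j, ω₁⁽ⁱ⁾, η₁⁽ⁱ⁾, ω₂⁽ⁱ⁾, η₂⁽ⁱ⁾`): the alternatives
`logs_alternatives` at `u = (y; ω₁⁽ⁱ⁾ | ω₂^{(e s)}; (1; η₁⁽ⁱ⁾ | η₂^{(e s)}))`, blocks `Fin k ⊕ S`
(`S` the non-CM indices), feed `logs_core_of_alternatives`.
[cite: HuberWustholz2022, Thm. 15.3 (1),(3) p. 145; Prop. 15.20; Thm. 6.2] [cite: BakerWustholz2007, Thm. 6.15, Thm. 6.1, §6.8] -/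
theorem logs_core {k : ℕ} {L : Fin k → PeriodPair}
    (hL : ∀ i, IsAlgebraic ℚ (L i).g₂ ∧ IsAlgebraic ℚ (L i).g₃)
    (hiso : ∀ i j, i ≠ j → ¬ (L i).IsIsogenousTo (L j))
    {ι : Type} [Fintype ι] {y : ι → ℂ} (hy : ∀ j, IsAlgebraic ℚ (cexp (y j)))
    (hyind : LinearIndependent ℚ y)
    (α : ℂ) (μ : ι → ℂ) (a b c d : Fin k → ℂ) (hα : IsAlgebraic ℚ α)
    (hμ : ∀ j, IsAlgebraic ℚ (μ j))
    (habcd : ∀ i, IsAlgebraic ℚ (a i) ∧ IsAlgebraic ℚ (b i) ∧ IsAlgebraic ℚ (c i) ∧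
      IsAlgebraic ℚ (d i))
    (hcm : ∀ i, (L i).HasCM → b i = 0 ∧ d i = 0)
    (hsum : α + ∑ j, μ j * y j +
      ∑ i, (a i * (L i).ω₁ + b i * (L i).ω₂ + c i * (L i).η₁ + d i * (L i).η₂) = 0) :
    α = 0 ∧ (∀ j, μ j = 0) ∧ ∀ i, a i = 0 ∧ b i = 0 ∧ c i = 0 ∧ d i = 0 := by
  -- adapted from `HuberWustholzManyCurvePeriods_of_std_torsHyperplane`
  classical
  -- the non-CM indices
  let S : Type := {i : Fin k // ¬ (L i).HasCM}
  let e : S → Fin k := Subtype.val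
  have he : Function.Injective e := Subtype.val_injective
  have hS : ∀ s : S, ¬ (L (e s)).HasCM := fun s => s.2
  have hS' : ∀ i, ¬ (L i).HasCM → ∃ s : S, e s = i := fun i hi => ⟨⟨i, hi⟩, rfl⟩
  refine logs_core_of_alternatives e he hS hS' hyind (fun hdep => ?_) α μ a b c d hα hμ habcd
    hcm hsum
  -- the block structure: CM classes have the single block `inl i`
  set cls : Fin k ⊕ S → Fin k := Sum.elim id e with hcls
  have hcm1 : ∀ b b' : Fin k ⊕ S, cls b = cls b' → (L (cls b)).HasCM → b = b' := by
    rintro (i | s) (i' | s') h hCM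
    · simpa [hcls] using h
    · simp only [hcls, Sum.elim_inl, Sum.elim_inr, id_eq] at h hCM
      exact absurd hCM (h ▸ hS s')
    · simp only [hcls, Sum.elim_inl, Sum.elim_inr, id_eq] at h hCM
      exact absurd hCM (hS s)
    · simp only [hcls, Sum.elim_inr] at h
      rw [he h]
  -- the period vectors of each block as integer combinations
  set m : Fin k ⊕ S → ℤ := Sum.elim (fun _ => 1) (fun _ => 0) with hm
  set n : Fin k ⊕ S → ℤ := Sum.elim (fun _ => 0) (fun _ => 1) with hn
  have hz : (fun b => (m b : ℂ) * (L (cls b)).ω₁ + (n b : ℂ) * (L (cls b)).ω₂) =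
      (Sum.elim (fun i => (L i).ω₁) (fun s => (L (e s)).ω₂) : Fin k ⊕ S → ℂ) := by
    funext b; rcases b with i | s <;> simp [hm, hn, hcls]
  have ht : (fun b => (m b : ℂ) * (L (cls b)).η₁ + (n b : ℂ) * (L (cls b)).η₂) =
      (Sum.elim (fun i => (L i).η₁) (fun s => (L (e s)).η₂) : Fin k ⊕ S → ℂ) := by
    funext b; rcases b with i | s <;> simp [hm, hn, hcls]
  -- the dependence, reindexed to the coordinates of the model
  have hdep' : ¬ QbarLinearIndependent
      (GaGmE.Std.coords y
        (fun b => (m b : ℂ) * (L (cls b)).ω₁ + (n b : ℂ) * (L (cls b)).ω₂)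
        (Sum.elim (fun _ : Unit => (1 : ℂ))
          (fun b => (m b : ℂ) * (L (cls b)).η₁ + (n b : ℂ) * (L (cls b)).η₂))) := by
    intro hQ
    apply hdep
    rw [lieCoords_eq_coords_comp, ← hz, ← ht]
    exact qbarLinearIndependent_comp_equiv _ hQ
  have key := logs_alternatives L hL hiso cls hcm1 1 y m n isAlgebraic_one hy hdep'
  rcases key with h0 | hp | ⟨i, r, hr, hsupp, hrz⟩
  · exact Or.inl h0
  · exact Or.inr (Or.inl hp)
  · refine Or.inr (Or.inr ⟨i, r, hr, fun b hb => hsupp b (by simpa [hcls] using hb), ?_⟩)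
    rw [← hrz]
    refine Finset.sum_congr rfl fun b _ => ?_
    rw [← hz]

/-! ## The CM blocks in normal form -/

/-- **`stub_logsManyCurve` at a fixed family, from its core at that family** (inline hypothesis
`hcore`: a vanishing combination with `bᵢ = dᵢ = 0` on the CM lattices is trivial): rewrite each
CM block in normal form (`ManyCurve.cm_normalForm`: `ω₂ = pω₁`, `η₂ = qω₁ + rη₁`), apply the core
to the rewritten (still algebraic) coefficients, and read off `α = 0`, `μ = 0`, the vanishing of
every block and `aᵢ = bᵢ = cᵢ = dᵢ = 0` on the non-CM blocks. The tree's
`HuberWustholzManyCurvePeriods_of_core_at` with the extra term `Σ μ_j y_j` riding along.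
[cite: HuberWustholz2022, Thm. 15.3 (1),(3) p. 145; Prop. 15.9 / 15.20 pp. 150–154] [cite: Masser1975, Ch. III Thm. III, Lemma 3.1] -/
theorem logs_of_core_at {k : ℕ} {L : Fin k → PeriodPair}
    (hL : ∀ i, IsAlgebraic ℚ (L i).g₂ ∧ IsAlgebraic ℚ (L i).g₃)
    {ι : Type} [Fintype ι] (y : ι → ℂ)
    (hcore : ∀ (α : ℂ) (μ : ι → ℂ) (a b c d : Fin k → ℂ), IsAlgebraic ℚ α →
      (∀ j, IsAlgebraic ℚ (μ j)) →
      (∀ i, IsAlgebraic ℚ (a i) ∧ IsAlgebraic ℚ (b i) ∧ IsAlgebraic ℚ (c i) ∧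
        IsAlgebraic ℚ (d i)) →
      (∀ i, (L i).HasCM → b i = 0 ∧ d i = 0) →
      α + ∑ j, μ j * y j +
          ∑ i, (a i * (L i).ω₁ + b i * (L i).ω₂ + c i * (L i).η₁ + d i * (L i).η₂) = 0 →
        α = 0 ∧ (∀ j, μ j = 0) ∧ ∀ i, a i = 0 ∧ b i = 0 ∧ c i = 0 ∧ d i = 0)
    (α : ℂ) (μ : ι → ℂ) (a b c d : Fin k → ℂ) (hα : IsAlgebraic ℚ α)
    (hμ : ∀ j, IsAlgebraic ℚ (μ j))
    (habcd : ∀ i, IsAlgebraic ℚ (a i) ∧ IsAlgebraic ℚ (b i) ∧ IsAlgebraic ℚ (c i) ∧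
      IsAlgebraic ℚ (d i))
    (hsum : α + ∑ j, μ j * y j +
      ∑ i, (a i * (L i).ω₁ + b i * (L i).ω₂ + c i * (L i).η₁ + d i * (L i).η₂) = 0) :
    α = 0 ∧ (∀ j, μ j = 0) ∧
      (∀ i, a i * (L i).ω₁ + b i * (L i).ω₂ + c i * (L i).η₁ + d i * (L i).η₂ = 0) ∧
      (∀ i, ¬ (L i).HasCM → a i = 0 ∧ b i = 0 ∧ c i = 0 ∧ d i = 0) := by
  -- adapted from `HuberWustholzManyCurvePeriods_of_core_at`
  choose ε p q r hε hp hq hr hcm hncm hnf using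
    fun i ↦ ManyCurve.cm_normalForm (L i) (hL i).1 (hL i).2
  -- the rewritten coefficients
  set a' : Fin k → ℂ := fun i ↦ a i + b i * p i + d i * q i with ha'
  set b' : Fin k → ℂ := fun i ↦ ε i * b i with hb'
  set c' : Fin k → ℂ := fun i ↦ c i + d i * r i with hc'
  set d' : Fin k → ℂ := fun i ↦ ε i * d i with hd'
  have hblock : ∀ i, a i * (L i).ω₁ + b i * (L i).ω₂ + c i * (L i).η₁ + d i * (L i).η₂ =
      a' i * (L i).ω₁ + b' i * (L i).ω₂ + c' i * (L i).η₁ + d' i * (L i).η₂ := fun i ↦ by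
    rw [hnf i (a i) (b i) (c i) (d i)]
  have hsum' : α + ∑ j, μ j * y j +
      ∑ i, (a' i * (L i).ω₁ + b' i * (L i).ω₂ + c' i * (L i).η₁ + d' i * (L i).η₂) = 0 := by
    rw [← Finset.sum_congr rfl fun i _ ↦ hblock i]
    exact hsum
  have halg' : ∀ i, IsAlgebraic ℚ (a' i) ∧ IsAlgebraic ℚ (b' i) ∧ IsAlgebraic ℚ (c' i) ∧
      IsAlgebraic ℚ (d' i) := fun i ↦
    ⟨((habcd i).1.add ((habcd i).2.1.mul (hp i))).add ((habcd i).2.2.2.mul (hq i)),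
      (hε i).mul (habcd i).2.1, (habcd i).2.2.1.add ((habcd i).2.2.2.mul (hr i)),
      (hε i).mul (habcd i).2.2.2⟩
  have hcm' : ∀ i, (L i).HasCM → b' i = 0 ∧ d' i = 0 := fun i hi ↦ by
    simp [hb', hd', hcm i hi]
  obtain ⟨hα0, hμ0, hzero⟩ := hcore α μ a' b' c' d' hα hμ halg' hcm' hsum'
  refine ⟨hα0, hμ0, fun i ↦ ?_, fun i hi ↦ ?_⟩
  · obtain ⟨h1, h2, h3, h4⟩ := hzero i
    rw [hblock i, h1, h2, h3, h4]
    ring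
  · obtain ⟨h1, h2, h3, h4⟩ := hzero i
    obtain ⟨hε1, hp0, hq0, hr0⟩ := hncm i hi
    simp only [ha', hb', hc', hd', hε1, hp0, hq0, hr0, mul_zero, add_zero, one_mul] at h1 h2 h3 h4
    exact ⟨h1, h2, h3, h4⟩

/-! ## The stub -/

/-- STUB `stub_logsManyCurve` — **BAKER + HUBER–WÜSTHOLZ 15.3 (1), JOINTLY, FOR PAIRWISE
NON-ISOGENOUS LATTICES.** Let `Λ₁, …, Λ_k` be pairwise non-isogenous lattices with algebraic
invariants (complex multiplication allowed) and `y_j` (`j ∈ ι`) `ℚ`-linearly independent logarithms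
of algebraic numbers (`e^{y_j} ∈ ℚ̄`). A vanishing combination
`α + Σ_j μ_j y_j + Σ_i (a_i ω₁⁽ⁱ⁾ + b_i ω₂⁽ⁱ⁾ + c_i η₁⁽ⁱ⁾ + d_i η₂⁽ⁱ⁾) = 0` with algebraic coefficients
has `α = 0`, every `μ_j = 0`, every block `a_i ω₁⁽ⁱ⁾ + ⋯ + d_i η₂⁽ⁱ⁾ = 0`, and
`a_i = b_i = c_i = d_i = 0` on the lattices without CM. Route: the alternatives at the point
`(y; ω₁⁽ⁱ⁾ | ω₂^{(e s)}; (1; η₁⁽ⁱ⁾ | η₂^{(e s)}))` of `Lie(𝔾ₘ^ι × P₀)` (`logs_alternatives`), excluded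
by `1 ≠ 0`, the `ℚ`-independence of `y` and the `ℝ`-independence of `ω₁, ω₂` (`logs_core`), and
the CM blocks in normal form (`logs_of_core_at`).
[cite: HuberWustholz2022, Thm 15.3 (1),(3), Thm 6.2, Rem. 15.11] [cite: BakerWustholz2007, Thm. 6.15, §6.8] -/
theorem stub_logsManyCurve : ∀ (k : ℕ) (L : Fin k → PeriodPair),
    (∀ i, IsAlgebraic ℚ (L i).g₂ ∧ IsAlgebraic ℚ (L i).g₃) →
    (∀ i j, i ≠ j → ¬ (L i).IsIsogenousTo (L j)) →
    ∀ (ι : Type) [Fintype ι] (y : ι → ℂ), (∀ j, IsAlgebraic ℚ (Complex.exp (y j))) → LinearIndependent ℚ y →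
    ∀ (α : ℂ) (μ : ι → ℂ) (a b c d : Fin k → ℂ), IsAlgebraic ℚ α → (∀ j, IsAlgebraic ℚ (μ j)) →
      (∀ i, IsAlgebraic ℚ (a i) ∧ IsAlgebraic ℚ (b i) ∧ IsAlgebraic ℚ (c i) ∧ IsAlgebraic ℚ (d i)) →
      α + ∑ j, μ j * y j + ∑ i, (a i * (L i).ω₁ + b i * (L i).ω₂ + c i * (L i).η₁ + d i * (L i).η₂) = 0 →
        α = 0 ∧ (∀ j, μ j = 0) ∧
          (∀ i, a i * (L i).ω₁ + b i * (L i).ω₂ + c i * (L i).η₁ + d i * (L i).η₂ = 0) ∧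
          (∀ i, ¬ (L i).HasCM → a i = 0 ∧ b i = 0 ∧ c i = 0 ∧ d i = 0) := by
  intro k L hL hiso ι _ y hy hyind α μ a b c d hα hμ habcd hsum
  exact logs_of_core_at hL y
    (fun α' μ' a' b' c' d' hα' hμ' habcd' hcm' hsum' =>
      logs_core hL hiso hy hyind α' μ' a' b' c' d' hα' hμ' habcd' hcm' hsum')
    α μ a b c d hα hμ habcd hsum

end Summit.KontsevichZagierPeriods.SymplecticScissors.RealOnePeriodRelations.LogLoopLayer

end
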